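import Summits.AtomisticToContinuum.Crystallization.Theorems.FrustratedLawDichotomyStrainedPatchHomPolar

/-!
# ISOMETRY INVARIANCE of the strained-patch predicates and the O(3) reduction of the PRUNE disjunct

Critic row 764 (ε′) (decomp-a2c hand-1 g19; sequel of `…StrainedPatchHomPolar`).  Every predicate of the 27623 strained-patch piece
(`ball`, `GoodAtScale`, `TightNearCap`, `BadNearCap`, `MoveUnstableCore`, `RemovalUnstableCore`, `NonEquilibriumCore`, `ExRec`,
`ExemptNear ρ ExRec`, `Sep`, `Admissible`) is a function of pairwise distances (and, for the fit / the one-atom move, of an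
existential isometry / point that can be transported), hence INVARIANT under `z ↦ R ∘ z` for a linear isometry `R` of `E3`.
Consequently the PRUNE DISJUNCT of the binding certificate target (`homFloor_of_prunedBoxSums`, critic row 764 (C)) —
«every injective realisation of the `G`-ball has `TightNearCap ∨ ExemptNear ExRec ∨ BadNearCap` at the centre» — transports from the
polar factor `U` to `G = R ∘ U` (`pruneFcc_comp`, `pruneHcp_comp`), and with `…HomPolar.forall_near_one_of_forall_selfAdjoint` the whole
pruned certificate need only be established for SELF-ADJOINT positive `U` with `‖U − 1‖ ≤ 1/4` (`prunedBoxSum_fcc_reduction`,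
`prunedBoxSum_hcp_reduction`).  DEF-FREE; standard axioms.  `--supports stmt-AtomisticToContinuum-27623`.
-/

noncomputable section

namespace Summit.AtomisticToContinuum.Crystallization.Theorems.FrustratedLawDichotomyStrainedPatchHomIsometry

open scoped BigOperators Classical
open Summit.AtomisticToContinuum.Crystallization.Theorems.ChargedEnergyGapNegative (E3)
open Summit.AtomisticToContinuum.Crystallization.Theorems.FrustratedLawDichotomyMotifLemmas (GoodAtScale)
open Summit.AtomisticToContinuum.Crystallization.Theorems.FrustratedLawDichotomyAveragingCut (ball mem_ball)
open Summit.AtomisticToContinuum.Crystallization.Theorems.FrustratedLawDichotomyAveragingRuleTightFree (TightNearCap BadNearCap)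
open Summit.AtomisticToContinuum.Crystallization.Theorems.FrustratedLawDichotomyExemptAbsorption (ExemptNear)
open Summit.AtomisticToContinuum.Crystallization.Theorems.FrustratedLawDichotomyExemptAbsorptionRecord
  (MoveUnstableCore RemovalUnstableCore NonEquilibriumCore)
open Summit.AtomisticToContinuum.Crystallization.Theorems.FrustratedLawDichotomyCollarCensus (Collar)
open Summit.AtomisticToContinuum.Crystallization.Theorems.FrustratedLawDichotomyStrainedPatchHomSplit
open Summit.AtomisticToContinuum.Crystallization.Theorems.FrustratedLawDichotomyStrainedPatchHomPolar

variable {N : ℕ}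

/-! ## §1. Distances, balls, separation, injectivity -/

/-- Distances are preserved. [formal bookkeeping] -/
theorem dist_comp (R : E3 ≃ₗᵢ[ℝ] E3) (y : Fin N → E3) (j k : Fin N) : dist ((⇑R ∘ y) j) ((⇑R ∘ y) k) = dist (y j) (y k) := by
  simp only [Function.comp_apply, LinearIsometryEquiv.dist_map]

/-- Undoing the isometry. [formal bookkeeping] -/
theorem symm_comp_comp (R : E3 ≃ₗᵢ[ℝ] E3) (y : Fin N → E3) : ⇑R.symm ∘ (⇑R ∘ y) = y := by
  funext k; simp

/-- `ball ρ (R ∘ y) i = ball ρ y i`. [folklore] -/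
theorem ball_comp (R : E3 ≃ₗᵢ[ℝ] E3) (ρ : ℝ) (y : Fin N → E3) (i : Fin N) : ball ρ (⇑R ∘ y) i = ball ρ y i := by
  ext j; rw [mem_ball, mem_ball, dist_comp]

/-- `Sep (R ∘ y) ↔ Sep y`. [folklore] -/
theorem sep_comp_iff (R : E3 ≃ₗᵢ[ℝ] E3) (y : Fin N → E3) :
    FrustratedLawDichotomyRangeCut.Sep (⇑R ∘ y) ↔ FrustratedLawDichotomyRangeCut.Sep y := by
  unfold FrustratedLawDichotomyRangeCut.Sep; simp only [dist_comp]

/-- `Injective (R ∘ y) ↔ Injective y`. [folklore] -/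
theorem injective_comp_iff (R : E3 ≃ₗᵢ[ℝ] E3) (y : Fin N → E3) : Function.Injective (⇑R ∘ y) ↔ Function.Injective y :=
  ⟨fun h => fun a b hab => h (by simp [hab]), fun h => R.injective.comp h⟩

/-- Membership of the range transports. [formal bookkeeping] -/
theorem mem_range_comp_iff (R : E3 ≃ₗᵢ[ℝ] E3) (y : Fin N → E3) (s : E3) : s ∈ Set.range (⇑R ∘ y) ↔ R.symm s ∈ Set.range y := by
  constructor
  · rintro ⟨k, rfl⟩; exact ⟨k, by simp⟩
  · rintro ⟨k, hk⟩; exact ⟨k, by simp [hk]⟩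

/-! ## §2. The fit predicate `GoodAtScale` -/

/-- One direction: a fit for `y` gives a fit for `R ∘ y` (transport `A ↦ R ∘ A`, `t ↦ R ∘ t`). [folklore] -/
theorem goodAtScale_comp {η D : ℝ} (R : E3 ≃ₗᵢ[ℝ] E3) {y : Fin N → E3} {i : Fin N} (h : GoodAtScale η D y i) :
    GoodAtScale η D (⇑R ∘ y) i := by
  obtain ⟨d, η', γ, A, hdD, hor⟩ := h
  refine ⟨d, η', γ, R.toLinearIsometry.comp A, hdD, ?_⟩
  -- the shared transport facts
  have hdist : ∀ s : E3, dist s ((⇑R ∘ y) i) = dist (R.symm s) (y i) := fun s => by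
    rw [Function.comp_apply, ← R.dist_map (R.symm s) (y i), LinearIsometryEquiv.apply_symm_apply]
  have hne : ∀ s : E3, s ≠ (⇑R ∘ y) i ↔ R.symm s ≠ y i := fun s => by
    rw [Function.comp_apply, not_iff_not]
    constructor
    · rintro rfl; simp
    · intro hs; rw [← hs]; simp
  rcases hor with ⟨t, hd, hγ, hη, hT, hpin, hpin', hgap⟩ | ⟨t, hd, hγ, hη, hT, hpin, hpin', hgap⟩
  · left
    refine ⟨fun u => R (t u), hd, hγ, hη, fun u => ⟨?_, ?_⟩, fun s hs hsi => ?_, ?_, fun s hs hsi hlt => ?_⟩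
    · obtain ⟨k, hk⟩ := (hT u).1; exact ⟨k, by simp [hk]⟩
    · have := (hT u).2
      calc ‖(R (t u) - (⇑R ∘ y) i) - d • (R.toLinearIsometry.comp A) (u : E3)‖
          = ‖R ((t u - y i) - d • A (u : E3))‖ := by simp [map_sub, map_smul]
        _ ≤ η' * d := by rw [LinearIsometryEquiv.norm_map]; exact this
    · rw [hdist]; exact hpin _ ((mem_range_comp_iff R y s).1 hs) ((hne s).1 hsi)
    · obtain ⟨s, hs, hsi, hle⟩ := hpin'
      refine ⟨R s, (mem_range_comp_iff R y _).2 (by simpa using hs), ?_, ?_⟩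
      · exact (hne (R s)).2 (by simpa using hsi)
      · rw [hdist]; simpa using hle
    · rw [hdist] at hlt ⊢
      obtain ⟨hle, ⟨u, hu⟩⟩ := hgap _ ((mem_range_comp_iff R y s).1 hs) ((hne s).1 hsi) hlt
      exact ⟨hle, ⟨u, by simp [hu]⟩⟩
  · right
    refine ⟨fun u => R (t u), hd, hγ, hη, fun u => ⟨?_, ?_⟩, fun s hs hsi => ?_, ?_, fun s hs hsi hlt => ?_⟩
    · obtain ⟨k, hk⟩ := (hT u).1; exact ⟨k, by simp [hk]⟩
    · have := (hT u).2
      calc ‖(R (t u) - (⇑R ∘ y) i) - d • (R.toLinearIsometry.comp A) (u : E3)‖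
          = ‖R ((t u - y i) - d • A (u : E3))‖ := by simp [map_sub, map_smul]
        _ ≤ η' * d := by rw [LinearIsometryEquiv.norm_map]; exact this
    · rw [hdist]; exact hpin _ ((mem_range_comp_iff R y s).1 hs) ((hne s).1 hsi)
    · obtain ⟨s, hs, hsi, hle⟩ := hpin'
      refine ⟨R s, (mem_range_comp_iff R y _).2 (by simpa using hs), ?_, ?_⟩
      · exact (hne (R s)).2 (by simpa using hsi)
      · rw [hdist]; simpa using hle
    · rw [hdist] at hlt ⊢
      obtain ⟨hle, ⟨u, hu⟩⟩ := hgap _ ((mem_range_comp_iff R y s).1 hs) ((hne s).1 hsi) hlt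
      exact ⟨hle, ⟨u, by simp [hu]⟩⟩

/-- ★ `GoodAtScale η D (R ∘ y) i ↔ GoodAtScale η D y i`. [folklore] -/
theorem goodAtScale_comp_iff {η D : ℝ} (R : E3 ≃ₗᵢ[ℝ] E3) (y : Fin N → E3) (i : Fin N) :
    GoodAtScale η D (⇑R ∘ y) i ↔ GoodAtScale η D y i :=
  ⟨fun h => by simpa only [symm_comp_comp] using goodAtScale_comp R.symm h, goodAtScale_comp R⟩

/-- `TightNearCap ρ D (R ∘ y) i ↔ TightNearCap ρ D y i`. [folklore] -/
theorem tightNearCap_comp_iff {ρ D : ℝ} (R : E3 ≃ₗᵢ[ℝ] E3) (y : Fin N → E3) (i : Fin N) :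
    TightNearCap ρ D (⇑R ∘ y) i ↔ TightNearCap ρ D y i := by
  unfold TightNearCap; simp only [ball_comp, goodAtScale_comp_iff]

/-- `BadNearCap ρ D (R ∘ y) i ↔ BadNearCap ρ D y i`. [folklore] -/
theorem badNearCap_comp_iff {ρ D : ℝ} (R : E3 ≃ₗᵢ[ℝ] E3) (y : Fin N → E3) (i : Fin N) :
    BadNearCap ρ D (⇑R ∘ y) i ↔ BadNearCap ρ D y i := by
  unfold BadNearCap; simp only [ball_comp, goodAtScale_comp_iff]

/-! ## §3. The one-atom tests and the exemption of record -/

/-- The local neighbour sets `{k ≠ j : dist (y k) (y j) ≤ Rm}` are invariant. [formal bookkeeping] -/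
theorem filter_comp (R : E3 ≃ₗᵢ[ℝ] E3) (Rm : ℝ) (y : Fin N → E3) (j : Fin N) :
    (Finset.univ.erase j).filter (fun k => dist ((⇑R ∘ y) k) ((⇑R ∘ y) j) ≤ Rm) =
      (Finset.univ.erase j).filter (fun k => dist (y k) (y j) ≤ Rm) := by
  simp only [dist_comp]

/-- One direction of the move test (transport the move point `p ↦ R p`). [folklore] -/
theorem moveUnstableCore_comp {ε Rm s : ℝ} (R : E3 ≃ₗᵢ[ℝ] E3) {y : Fin N → E3} {j : Fin N}
    (h : MoveUnstableCore ε Rm s N y j) : MoveUnstableCore ε Rm s N (⇑R ∘ y) j := by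
  obtain ⟨p, hp1, hp2, hgain⟩ := h
  refine ⟨R p, ?_, ?_, ?_⟩
  · simpa [Function.comp_apply, LinearIsometryEquiv.dist_map] using hp1
  · simpa [Function.comp_apply, LinearIsometryEquiv.dist_map] using hp2
  · rw [filter_comp]
    simpa [Function.comp_apply, LinearIsometryEquiv.dist_map] using hgain

/-- `MoveUnstableCore ε Rm s N (R ∘ y) j ↔ MoveUnstableCore ε Rm s N y j`. [folklore] -/
theorem moveUnstableCore_comp_iff {ε Rm s : ℝ} (R : E3 ≃ₗᵢ[ℝ] E3) (y : Fin N → E3) (j : Fin N) :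
    MoveUnstableCore ε Rm s N (⇑R ∘ y) j ↔ MoveUnstableCore ε Rm s N y j :=
  ⟨fun h => by simpa only [symm_comp_comp] using moveUnstableCore_comp R.symm h, moveUnstableCore_comp R⟩

/-- `RemovalUnstableCore eUp t Rm N (R ∘ y) j ↔ RemovalUnstableCore eUp t Rm N y j`. [folklore] -/
theorem removalUnstableCore_comp_iff {eUp t Rm : ℝ} (R : E3 ≃ₗᵢ[ℝ] E3) (y : Fin N → E3) (j : Fin N) :
    RemovalUnstableCore eUp t Rm N (⇑R ∘ y) j ↔ RemovalUnstableCore eUp t Rm N y j := by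
  unfold RemovalUnstableCore
  rw [filter_comp]
  simp only [Function.comp_apply, LinearIsometryEquiv.dist_map]

/-- `NonEquilibriumCore … N (R ∘ y) j ↔ NonEquilibriumCore … N y j`. [folklore] -/
theorem nonEquilibriumCore_comp_iff {eUp ε Rm s t : ℝ} (R : E3 ≃ₗᵢ[ℝ] E3) (y : Fin N → E3) (j : Fin N) :
    NonEquilibriumCore eUp ε Rm s t N (⇑R ∘ y) j ↔ NonEquilibriumCore eUp ε Rm s t N y j := by
  unfold NonEquilibriumCore; rw [moveUnstableCore_comp_iff, removalUnstableCore_comp_iff]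

/-- ★ The exemption of record is invariant: `ExRec N (R ∘ y) j ↔ ExRec N y j`. [folklore] -/
theorem exRec_comp_iff (R : E3 ≃ₗᵢ[ℝ] E3) (y : Fin N → E3) (j : Fin N) : ExRec N (⇑R ∘ y) j ↔ ExRec N y j := by
  unfold ExRec Collar
  simp only [ball_comp, nonEquilibriumCore_comp_iff, goodAtScale_comp_iff]

/-- `ExemptNear ρ ExRec (R ∘ y) i ↔ ExemptNear ρ ExRec y i`. [folklore] -/
theorem exemptNear_exRec_comp_iff {ρ : ℝ} (R : E3 ≃ₗᵢ[ℝ] E3) (y : Fin N → E3) (i : Fin N) :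
    ExemptNear ρ ExRec (⇑R ∘ y) i ↔ ExemptNear ρ ExRec y i := by
  unfold ExemptNear; simp only [ball_comp, exRec_comp_iff]

/-- ★ `Admissible M (R ∘ z) c ↔ Admissible M z c`. [folklore] -/
theorem admissible_comp_iff (R : E3 ≃ₗᵢ[ℝ] E3) {M : ℕ} (z : Fin M → E3) (c : Fin M) :
    Admissible M (⇑R ∘ z) c ↔ Admissible M z c := by
  unfold Admissible
  rw [injective_comp_iff, sep_comp_iff, tightNearCap_comp_iff, exemptNear_exRec_comp_iff, badNearCap_comp_iff]
  simp only [dist_comp]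

/-- The prune disjunct «tight ∨ exempt ∨ bad at the centre» is invariant. [folklore] -/
theorem pruneDisjunct_comp_iff (R : E3 ≃ₗᵢ[ℝ] E3) {M : ℕ} (z : Fin M → E3) (c : Fin M) :
    (TightNearCap (9 / 5) (3 / 2) (⇑R ∘ z) c ∨ ExemptNear (9 / 5) ExRec (⇑R ∘ z) c ∨ BadNearCap (9 / 5) (3 / 2) (⇑R ∘ z) c) ↔
      (TightNearCap (9 / 5) (3 / 2) z c ∨ ExemptNear (9 / 5) ExRec z c ∨ BadNearCap (9 / 5) (3 / 2) z c) := by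
  rw [tightNearCap_comp_iff, exemptNear_exRec_comp_iff, badNearCap_comp_iff]

/-! ## §4. Transport of realisations of a homogeneous ball and the O(3) reduction of the prune disjunct -/

/-- Realisations transport: if `z` realises the `(R ∘ U)`-fcc-type ball then `R⁻¹ ∘ z` realises the `U`-ball. [folklore] -/
theorem range_symm_comp_fcc (R : E3 ≃ₗᵢ[ℝ] E3) (U : E3 →L[ℝ] E3) (f : Fin 3 → E3) (ϱ : ℝ) {M : ℕ} {z : Fin M → E3}
    {c : Fin M} (hz : Set.range z = {x | dist x (z c) ≤ ϱ ∧ ∃ a : Fin 3 → ℤ, x = z c + latPt ((R : E3 →L[ℝ] E3).comp U) f a}) :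
    Set.range (⇑R.symm ∘ z) = {x | dist x ((⇑R.symm ∘ z) c) ≤ ϱ ∧ ∃ a : Fin 3 → ℤ, x = (⇑R.symm ∘ z) c + latPt U f a} := by
  ext x
  rw [mem_range_comp_iff, LinearIsometryEquiv.symm_symm, hz]
  simp only [Set.mem_setOf_eq, Function.comp_apply, latPt_comp]
  constructor
  · rintro ⟨hd, a, ha⟩
    refine ⟨?_, a, ?_⟩
    · rwa [← R.symm.dist_map, LinearIsometryEquiv.symm_apply_apply] at hd
    · apply R.injective
      simp [ha]
  · rintro ⟨hd, a, ha⟩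
    refine ⟨?_, a, ?_⟩
    · rwa [← R.dist_map, LinearIsometryEquiv.apply_symm_apply] at hd
    · have := congrArg R ha
      simpa using this

/-- Realisations transport, hcp type (two sublattices, shift `U (s + ξ)`). [folklore] -/
theorem range_symm_comp_hcp (R : E3 ≃ₗᵢ[ℝ] E3) (U : E3 →L[ℝ] E3) (f : Fin 3 → E3) (t : E3) (ϱ : ℝ) {M : ℕ}
    {z : Fin M → E3} {c : Fin M}
    (hz : Set.range z = {x | dist x (z c) ≤ ϱ ∧ ∃ a : Fin 3 → ℤ, x = z c + latPt ((R : E3 →L[ℝ] E3).comp U) f a ∨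
      x = z c + latPt ((R : E3 →L[ℝ] E3).comp U) f a + ((R : E3 →L[ℝ] E3).comp U) t}) :
    Set.range (⇑R.symm ∘ z) = {x | dist x ((⇑R.symm ∘ z) c) ≤ ϱ ∧ ∃ a : Fin 3 → ℤ, x = (⇑R.symm ∘ z) c + latPt U f a ∨
      x = (⇑R.symm ∘ z) c + latPt U f a + U t} := by
  ext x
  rw [mem_range_comp_iff, LinearIsometryEquiv.symm_symm, hz]
  simp only [Set.mem_setOf_eq, Function.comp_apply, latPt_comp, ContinuousLinearMap.comp_apply]
  constructor
  · rintro ⟨hd, a, ha⟩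
    refine ⟨?_, a, ?_⟩
    · rwa [← R.symm.dist_map, LinearIsometryEquiv.symm_apply_apply] at hd
    · rcases ha with ha | ha
      · left; apply R.injective; simp [ha]
      · right; apply R.injective
        simp only [ha, map_add, LinearIsometryEquiv.apply_symm_apply]
        rfl
  · rintro ⟨hd, a, ha⟩
    refine ⟨?_, a, ?_⟩
    · rwa [← R.dist_map, LinearIsometryEquiv.apply_symm_apply] at hd
    · rcases ha with ha | ha
      · left; have := congrArg R ha; simpa using this
      · right; have := congrArg R ha
        simp only [map_add, LinearIsometryEquiv.apply_symm_apply] at this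
        rw [this]; rfl

/-- ★★ **PRUNE DISJUNCT, fcc type, transports from `U` to `R ∘ U`.** [folklore] -/
theorem pruneFcc_comp (R : E3 ≃ₗᵢ[ℝ] E3) (U : E3 →L[ℝ] E3) (f : Fin 3 → E3) (ϱ : ℝ)
    (h : ∀ (M : ℕ) (z : Fin M → E3) (c : Fin M), Function.Injective z →
      Set.range z = {x | dist x (z c) ≤ ϱ ∧ ∃ a : Fin 3 → ℤ, x = z c + latPt U f a} →
      TightNearCap (9 / 5) (3 / 2) z c ∨ ExemptNear (9 / 5) ExRec z c ∨ BadNearCap (9 / 5) (3 / 2) z c) :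
    ∀ (M : ℕ) (z : Fin M → E3) (c : Fin M), Function.Injective z →
      Set.range z = {x | dist x (z c) ≤ ϱ ∧ ∃ a : Fin 3 → ℤ, x = z c + latPt ((R : E3 →L[ℝ] E3).comp U) f a} →
      TightNearCap (9 / 5) (3 / 2) z c ∨ ExemptNear (9 / 5) ExRec z c ∨ BadNearCap (9 / 5) (3 / 2) z c := by
  intro M z c hz hrange
  have h' := h M (⇑R.symm ∘ z) c ((injective_comp_iff R.symm z).2 hz) (range_symm_comp_fcc R U f ϱ hrange)
  have hzR : z = ⇑R ∘ (⇑R.symm ∘ z) := by funext k; simp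
  rw [hzR, pruneDisjunct_comp_iff]
  exact h'

/-- ★★ **PRUNE DISJUNCT, hcp type, transports from `U` to `R ∘ U`.** [folklore] -/
theorem pruneHcp_comp (R : E3 ≃ₗᵢ[ℝ] E3) (U : E3 →L[ℝ] E3) (f : Fin 3 → E3) (t : E3) (ϱ : ℝ)
    (h : ∀ (M : ℕ) (z : Fin M → E3) (c : Fin M), Function.Injective z →
      Set.range z = {x | dist x (z c) ≤ ϱ ∧ ∃ a : Fin 3 → ℤ, x = z c + latPt U f a ∨ x = z c + latPt U f a + U t} →
      TightNearCap (9 / 5) (3 / 2) z c ∨ ExemptNear (9 / 5) ExRec z c ∨ BadNearCap (9 / 5) (3 / 2) z c) :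
    ∀ (M : ℕ) (z : Fin M → E3) (c : Fin M), Function.Injective z →
      Set.range z = {x | dist x (z c) ≤ ϱ ∧ ∃ a : Fin 3 → ℤ, x = z c + latPt ((R : E3 →L[ℝ] E3).comp U) f a ∨
        x = z c + latPt ((R : E3 →L[ℝ] E3).comp U) f a + ((R : E3 →L[ℝ] E3).comp U) t} →
      TightNearCap (9 / 5) (3 / 2) z c ∨ ExemptNear (9 / 5) ExRec z c ∨ BadNearCap (9 / 5) (3 / 2) z c := by
  intro M z c hz hrange
  have h' := h M (⇑R.symm ∘ z) c ((injective_comp_iff R.symm z).2 hz) (range_symm_comp_hcp R U f t ϱ hrange)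
  have hzR : z = ⇑R ∘ (⇑R.symm ∘ z) := by funext k; simp
  rw [hzR, pruneDisjunct_comp_iff]
  exact h'

/-- ★★★ **PRUNED fcc CERTIFICATE REDUCES TO THE POLAR FACTOR**: if for every self-adjoint positive `U` with `‖U − 1‖ ≤ 1/4` either every
injective realisation of the `U`-fcc ball (radius `ϱ`, frame `f`) is pruned (tight ∨ exempt ∨ bad at the centre) or the floor inequality
`m ≤ (Σ_{b ∈ box} W ‖latPt U f b‖)/2 − e` holds, then the same dichotomy holds for every `G` with `‖G − 1‖ ≤ 1/4`. [folklore] -/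
theorem prunedBoxSum_fcc_reduction {m e ϱ : ℝ} {W : ℝ → ℝ} {box : Finset (Fin 3 → ℤ)} {f : Fin 3 → E3}
    (hU : ∀ U : E3 →L[ℝ] E3, (∀ v w : E3, inner ℝ (U v) w = inner ℝ v (U w)) → (∀ w : E3, 0 ≤ inner ℝ w (U w)) → ‖U - 1‖ ≤ 1 / 4 →
      (∀ (M : ℕ) (z : Fin M → E3) (c : Fin M), Function.Injective z →
        Set.range z = {x | dist x (z c) ≤ ϱ ∧ ∃ a : Fin 3 → ℤ, x = z c + latPt U f a} →
        TightNearCap (9 / 5) (3 / 2) z c ∨ ExemptNear (9 / 5) ExRec z c ∨ BadNearCap (9 / 5) (3 / 2) z c) ∨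
      m ≤ (∑ b ∈ box, W ‖latPt U f b‖) / 2 - e) :
    ∀ G : E3 →L[ℝ] E3, ‖G - 1‖ ≤ 1 / 4 →
      (∀ (M : ℕ) (z : Fin M → E3) (c : Fin M), Function.Injective z →
        Set.range z = {x | dist x (z c) ≤ ϱ ∧ ∃ a : Fin 3 → ℤ, x = z c + latPt G f a} →
        TightNearCap (9 / 5) (3 / 2) z c ∨ ExemptNear (9 / 5) ExRec z c ∨ BadNearCap (9 / 5) (3 / 2) z c) ∨
      m ≤ (∑ b ∈ box, W ‖latPt G f b‖) / 2 - e := by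
  refine forall_near_one_of_forall_selfAdjoint ?_ hU
  rintro R U (h | h)
  · exact Or.inl (pruneFcc_comp R U f ϱ h)
  · right; simpa only [norm_latPt_comp] using h

/-- ★★★ **PRUNED hcp CERTIFICATE REDUCES TO THE POLAR FACTOR** (shift `s + ξ` with `‖ξ‖ ≤ 1/4` a parameter). [folklore] -/
theorem prunedBoxSum_hcp_reduction {m e ϱ : ℝ} {W : ℝ → ℝ} {box box' : Finset (Fin 3 → ℤ)} {f : Fin 3 → E3} {s : E3}
    (hU : ∀ (U : E3 →L[ℝ] E3) (ξ : E3), (∀ v w : E3, inner ℝ (U v) w = inner ℝ v (U w)) → (∀ w : E3, 0 ≤ inner ℝ w (U w)) →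
      ‖U - 1‖ ≤ 1 / 4 → ‖ξ‖ ≤ 1 / 4 →
      (∀ (M : ℕ) (z : Fin M → E3) (c : Fin M), Function.Injective z →
        Set.range z = {x | dist x (z c) ≤ ϱ ∧ ∃ a : Fin 3 → ℤ, x = z c + latPt U f a ∨ x = z c + latPt U f a + U (s + ξ)} →
        TightNearCap (9 / 5) (3 / 2) z c ∨ ExemptNear (9 / 5) ExRec z c ∨ BadNearCap (9 / 5) (3 / 2) z c) ∨
      m ≤ (∑ b ∈ box, W ‖latPt U f b‖ + ∑ b ∈ box', W ‖latPt U f b + U (s + ξ)‖) / 2 - e) :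
    ∀ (G : E3 →L[ℝ] E3) (ξ : E3), ‖G - 1‖ ≤ 1 / 4 → ‖ξ‖ ≤ 1 / 4 →
      (∀ (M : ℕ) (z : Fin M → E3) (c : Fin M), Function.Injective z →
        Set.range z = {x | dist x (z c) ≤ ϱ ∧ ∃ a : Fin 3 → ℤ, x = z c + latPt G f a ∨ x = z c + latPt G f a + G (s + ξ)} →
        TightNearCap (9 / 5) (3 / 2) z c ∨ ExemptNear (9 / 5) ExRec z c ∨ BadNearCap (9 / 5) (3 / 2) z c) ∨
      m ≤ (∑ b ∈ box, W ‖latPt G f b‖ + ∑ b ∈ box', W ‖latPt G f b + G (s + ξ)‖) / 2 - e := by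
  intro G ξ hG hξ
  revert hξ
  refine forall_near_one_of_forall_selfAdjoint
    (P := fun G => ‖ξ‖ ≤ 1 / 4 →
      (∀ (M : ℕ) (z : Fin M → E3) (c : Fin M), Function.Injective z →
        Set.range z = {x | dist x (z c) ≤ ϱ ∧ ∃ a : Fin 3 → ℤ, x = z c + latPt G f a ∨ x = z c + latPt G f a + G (s + ξ)} →
        TightNearCap (9 / 5) (3 / 2) z c ∨ ExemptNear (9 / 5) ExRec z c ∨ BadNearCap (9 / 5) (3 / 2) z c) ∨
      m ≤ (∑ b ∈ box, W ‖latPt G f b‖ + ∑ b ∈ box', W ‖latPt G f b + G (s + ξ)‖) / 2 - e)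
    ?_ (fun U hsa hpos hU1 hξ => hU U ξ hsa hpos hU1 hξ) G hG
  rintro R U h hξ
  rcases h hξ with h | h
  · exact Or.inl (pruneHcp_comp R U f (s + ξ) ϱ h)
  · right; simpa only [norm_latPt_comp, norm_latPt_add_comp] using h

end Summit.AtomisticToContinuum.Crystallization.Theorems.FrustratedLawDichotomyStrainedPatchHomIsometry

end
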